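import Literature.IUT.HodgeTheaters.TemperedCoveringsCor23OfSpecialFibreDecompGeneral
import Literature.AnabelianGeometry.SemiGraphs.TemperedDecompositionTransport
import HarnessLib

/-!
# [IUTchI] Cor. 2.3 (iv) at a general `ℍ`: the law `hHstab` from "`G_k` acts on the SEMI-GRAPH OF ANABELIOIDS `𝔾` and
# stabilizes `ℍ`" (rows «COR23-P4-HSTAB-GENERAL» / GAP-LEDGER G-w4d052-g6-1: (P4-i) consumed, (P4-ii) displayed)

Mochizuki, *Inter-universal Teichmüller theory I: construction of Hodge theaters*, kurims manuscript (May 2020), §2 p. 47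
l. 22–24 ("suppose … that the sub-semi-graph `ℍ ⊆ 𝔾` is stabilized by the natural action of `G_k` on `𝔾`"), Cor. 2.3 (i)
p. 47 ("the natural outer actions of `G_k` on `Δ^tp_X`, `Δ̂_X` determine natural outer actions of `G_k` on `Δ^tp_{X,ℍ}`,
`Δ̂_{X,ℍ}`"), (iv) p. 47, proof p. 49 l. 33–34 [cite: Mochizuki2012, Cor 2.3 pp.47-49] (D-0012 claim key; series status
DISPUTED; nothing of the series is asserted here; the [IUTchI] items are `[claim: Mochizuki2012, status: disputed]`);
Mochizuki, *Semi-graphs of anabelioids*, Publ. RIMS **42** (2006), Prop. 3.6 (iv) p. 39 (functoriality of `B^temp`), Ex. 3.10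
p. 44 [cite: MochizukiSemiAnbd2006, Prop 3.6(iv) p.39].

PROOF-ONLY sequel (abc-iut cell; seat abc-iut-w4-d052 gen 6; L5-lead RULINGS #102/#104) of
`TemperedCoveringsCor23OfSpecialFibreDecompGeneral.lean` (p479637; Cor. 2.3 (iv) at general `ℍ` on LAW `{hA, hB, hHstab}`)
using abc-iut-w4-d052's `TemperedDecompositionTransport.lean` (GAP G-w4d052-g6-1 (P4-i):
`exists_conj_map_eq_of_induces` — decomposition subgroups transport along `ℍ`-stabilising automorphisms of the
semi-graph of anabelioids).  The group-level law `hHstab` ("the `Π^tp_X`-conjugacy class of `Π^tp_ℍ` is stable") is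
DERIVED, for the record's own sub-semi-graph `ℍ := P.H` (which the record makes `Π`-stable: `P.H_stable`) and EVERY
`TpH ∈ S.chart.decompSubgroups P.H`, from the GRAPHICITY LAW (P4-ii) — print's hypothesis "the natural action of `G_k` on
`𝔾`" read as an action on the SEMI-GRAPH OF ANABELIOIDS `G^c` compatible with the outer action on `Π^tp_𝔾`:

  `hgr : ∀ g : Π^tp_X, ∃ F : Hom G^c G^c, F locally trivial ∧ F.base = (P.actGraph₀ g).hom ∧
         F induces autOfConj g on π₁^temp(G^c)` (`Hom.Induces`, abc-iut-L3-t2's Prop. 3.6 (iv) form).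

* `hHstab_of_mem_decompSubgroups_of_graphic (P) (hgr) (hTpH)` — `hHstab` for every decomposition group of `P.H`;
* `cor23_i_to_v_ofSpecialFibre_closureH_of_piData_of_mem_decompSubgroups_of_graphic` — rows (i)–(v) at the genuine datum
  for `TpH ∈ decompSubgroups S.chart P.H`: laws `{hA, hB}` + the graphicity law `hgr` + the FACT-INSTANCE `hcoh`.

BINDER CENSUS (classes of L5-lead RULINGS #101 (2)): DATA = `X`, `d`, `S`, `Σ`/`Σ̂` + side conditions, `TpH`,
`hTpH : TpH ∈ S.chart.decompSubgroups P.H`, `cuspMeetsH`, `T`, `P` (whose fields `P.H`, `P.H_connected`, `P.H_stable`,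
`P.baseVertex_mem` supply `ℍ`, its connectedness, its `Π`-stability and a vertex), `[Finite S.Gc.graph.Vertex/Edge]` ·
DATUM-INTERNAL = `h36`, `S.hyp` · FACT-INSTANCE = `hcoh` ([SemiAnbd] Ex. 2.10 coherence of `G^c`; (v) only) · LAW = `hA`,
`hB` (Cor. 2.3 (iii) (a)/(b) centraliser laws; `hB` idle for finite `Σ̂`), **`hgr`** = (P4-ii): NOT a field of
`SpecialFibreTower.PiData` (which pins the `Π`-action on the underlying semi-graph only — `actGraph₀`,
`actGraph₀_vertexMap`, `H_stable`); an ORIGIN-datum / [SemiAnbd] Cor. 3.9-instance candidate (L3-lead Q5), displayed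
here verbatim so that the lead can class it.  GONE: `hHstab`.  Model-RELATIVE; typed ≠ discharged; no definition, no
instance, no new `Prop` fact; nothing here bears on [IUTchIII] Cor. 3.12 or asserts that abc is proved or refuted.
-/

noncomputable section

namespace Literature.IUT.HodgeTheaters

open CategoryTheory
open _root_.Topology
open scoped Pointwise
open Literature.AnabelianGeometry.SemiGraphs
open Literature.AnabelianGeometry.SemiGraphs.ProfiniteSemiGraph (TemperedPiChart)
open Literature.AnabelianGeometry.SemiGraphs.ProfiniteSemiGraph.TemperedPiChart (exists_conj_map_eq_of_induces)
open Literature.AnabelianGeometry.AbsoluteAnabelian (IsCommensurablyTerminal)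

namespace StableCurveTemperedData

/-! ### A. `hHstab` for the decomposition groups of the record's `Π`-stable sub-semi-graph, from graphicity -/

section Stab

variable {p : ℕ} [Fact p.Prime] (X : TemperedCurve p) (d : X.GroupLevelData)
  (S : SpecialFibreData (X.toTemperedArithmeticGroup d)) (TpH : Subgroup S.chart.G)
  (T : SpecialFibreTower X.DeltaTemp)

/-- **`ℍ` is `Π`-stable in BOTH directions** for the record's sub-semi-graph: `v ∈ ℍ ↔ g · v ∈ ℍ` and likewise for edges
(`P.H_stable` for `g` and for `g⁻¹`; `actGraph₀` is a homomorphism to `Aut 𝔾^c`). [cite: Mochizuki2012, Cor 2.3 p.47] -/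
theorem H_mem_iff_actGraph₀_mem (P : SpecialFibreTower.PiData X d S T) (g : X.PiTemp) :
    (∀ v, v ∈ P.H.verts ↔ (P.actGraph₀ g).hom.vertexMap v ∈ P.H.verts) ∧
      ∀ e, e ∈ P.H.edges ↔ (P.actGraph₀ g).hom.edgeMap e ∈ P.H.edges := by
  have h1 : P.actGraph₀ g⁻¹ * P.actGraph₀ g = 1 := by rw [← map_mul, inv_mul_cancel, map_one]
  refine ⟨fun v => ⟨(P.H_stable g).1 v, fun hv => ?_⟩, fun e => ⟨(P.H_stable g).2 e, fun he => ?_⟩⟩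
  · have h2 := congrArg (fun a : Aut S.Gc.graph => a.hom.vertexMap v) h1
    have h3 : (P.actGraph₀ g⁻¹).hom.vertexMap ((P.actGraph₀ g).hom.vertexMap v) = v := h2
    rw [← h3]
    exact (P.H_stable g⁻¹).1 _ hv
  · have h2 := congrArg (fun a : Aut S.Gc.graph => a.hom.edgeMap e) h1
    have h3 : (P.actGraph₀ g⁻¹).hom.edgeMap ((P.actGraph₀ g).hom.edgeMap e) = e := h2
    rw [← h3]
    exact (P.H_stable g⁻¹).2 _ he

/-- **`hHstab` DERIVED for every decomposition group of the record's `ℍ` from the GRAPHICITY law (P4-ii)** ([IUTchI]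
Cor. 2.3 (i), second sentence, group form): if the conjugation action of each `g ∈ Π^tp_X` on `π₁^temp(G^c)` is induced
by a locally trivial automorphism of the semi-graph of anabelioids `G^c` whose underlying semi-graph automorphism is the
record's `actGraph₀ g`, then `autOfConj g` carries every `TpH ∈ decompSubgroups S.chart P.H` to a `π₁^temp(G^c)`-conjugate
of itself (abc-iut-w4-d052's `exists_conj_map_eq_of_induces` + `P.H_stable`). [cite: Mochizuki2012, Cor 2.3(i) p.47] -/
theorem hHstab_of_mem_decompSubgroups_of_graphic (P : SpecialFibreTower.PiData X d S T)
    (hgr : ∀ g : X.PiTemp, ∃ F : ProfiniteSemiGraph.Hom S.Gc S.Gc, F.IsLocallyTrivial ∧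
      F.base = (P.actGraph₀ g).hom ∧
      F.Induces S.chart S.chart ⟨S.autHom P.admissibleKer_normal_pi g, S.continuous_autHom P.admissibleKer_normal_pi g⟩)
    (hTpH : TpH ∈ S.chart.decompSubgroups P.H) :
    ∀ g : X.PiTemp, ∃ t : S.chart.G,
      TpH.map (S.autOfConj P.admissibleKer_normal_pi g).toMulEquiv.toMonoidHom = MulAut.conj t • TpH := by
  intro g
  obtain ⟨F, hlt, hbase, hind⟩ := hgr g
  haveI : CategoryTheory.IsIso (C := SemiGraph) F.base := by rw [hbase]; infer_instance
  obtain ⟨hV, hE⟩ := H_mem_iff_actGraph₀_mem X d S T P g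
  obtain ⟨t, ht⟩ := exists_conj_map_eq_of_induces F hlt S.chart hind
    (fun v => by rw [hbase]; exact hV v) (fun e => by rw [hbase]; exact hE e) hTpH
  exact ⟨t, ht⟩

end Stab

/-! ### B. Cor. 2.3 (i)–(v) at the record's `ℍ` for `Π^tp_ℍ ∈ decompSubgroups`: laws `{hA, hB}` + graphicity + `hcoh` -/

section Block

variable {p : ℕ} [Fact p.Prime] (X : TemperedCurve p) (d : X.GroupLevelData)
  (S : SpecialFibreData (X.toTemperedArithmeticGroup d)) (h36 : S.Gc.Prop36Hypotheses)
  (Sigma SigmaHat : Set ℕ) (hsub : Sigma ⊆ SigmaHat) (hne : Sigma.Nonempty)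
  (hprime : ∀ q ∈ SigmaHat, q.Prime) (hp : p ∉ Sigma)
  (TpH : Subgroup S.chart.G)
  (cuspMeetsH : {x : X.Pt // X.IsCusp x} → Prop)
  (T : SpecialFibreTower X.DeltaTemp)

/-- **[IUTchI] Cor. 2.3 (i)–(v) AS TYPED at the genuine datum, print's `Π̂_ℍ`, for the RECORD's `Π`-stable connected
sub-semi-graph `ℍ := P.H` and EVERY `Π^tp_ℍ := TpH ∈ decompSubgroups S.chart P.H`**, `hHstab` derived from graphicity:
laws `{hA, hB}` + `hgr` (P4-ii) + the FACT-INSTANCE `hcoh`; the side conditions "`ℍ` connected / has a vertex" are the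
record's `P.H_connected` / `P.baseVertex_mem`. [cite: Mochizuki2012, Cor 2.3 pp.47-50] -/
theorem cor23_i_to_v_ofSpecialFibre_closureH_of_piData_of_mem_decompSubgroups_of_graphic
    (P : SpecialFibreTower.PiData X d S T)
    (hA : (∃ l ∈ SigmaHat, l ∉ Sigma ∧ l ≠ p) →
      ∀ (i : ℕ) (a : (ofSpecialFibre X d S h36 Sigma SigmaHat hsub hne hprime hp TpH
      ((TpH.map (TemperedGraphGroupData.exists_completion_of_prop36 S.Gc h36
        S.chart).choose_spec.choose.toMonoidHom).topologicalClosure) (Subgroup.le_topologicalClosure _) cuspMeetsH).DeltaHat),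
        (∀ x ∈ ((OfSpecialFibre.towerOfSpecialFibreTower X d T Sigma SigmaHat hsub hne hprime S h36 hp TpH
        ((TpH.map (TemperedGraphGroupData.exists_completion_of_prop36 S.Gc h36
        S.chart).choose_spec.choose.toMonoidHom).topologicalClosure) (Subgroup.le_topologicalClosure _)
        cuspMeetsH).Jhat i).subgroupOf (ofSpecialFibre X d S h36 Sigma SigmaHat hsub hne hprime hp TpH
      ((TpH.map (TemperedGraphGroupData.exists_completion_of_prop36 S.Gc h36
        S.chart).choose_spec.choose.toMonoidHom).topologicalClosure) (Subgroup.le_topologicalClosure _) cuspMeetsH).DeltaHat,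
          x ∈ (ofSpecialFibre X d S h36 Sigma SigmaHat hsub hne hprime hp TpH
      ((TpH.map (TemperedGraphGroupData.exists_completion_of_prop36 S.Gc h36
        S.chart).choose_spec.choose.toMonoidHom).topologicalClosure) (Subgroup.le_topologicalClosure _) cuspMeetsH).ρHat.ker → a * x = x * a) →
        a ∈ ((OfSpecialFibre.towerOfSpecialFibreTower X d T Sigma SigmaHat hsub hne hprime S h36 hp TpH
        ((TpH.map (TemperedGraphGroupData.exists_completion_of_prop36 S.Gc h36
        S.chart).choose_spec.choose.toMonoidHom).topologicalClosure) (Subgroup.le_topologicalClosure _)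
        cuspMeetsH).Jhat i).subgroupOf (ofSpecialFibre X d S h36 Sigma SigmaHat hsub hne hprime hp TpH
      ((TpH.map (TemperedGraphGroupData.exists_completion_of_prop36 S.Gc h36
        S.chart).choose_spec.choose.toMonoidHom).topologicalClosure) (Subgroup.le_topologicalClosure _) cuspMeetsH).DeltaHat)
    (hB : SigmaHat = {q | q.Prime} →
      ∀ (i : ℕ) (a : (ofSpecialFibre X d S h36 Sigma SigmaHat hsub hne hprime hp TpH
      ((TpH.map (TemperedGraphGroupData.exists_completion_of_prop36 S.Gc h36
        S.chart).choose_spec.choose.toMonoidHom).topologicalClosure) (Subgroup.le_topologicalClosure _) cuspMeetsH).DeltaHat),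
        (∀ x ∈ ((OfSpecialFibre.towerOfSpecialFibreTower X d T Sigma SigmaHat hsub hne hprime S h36 hp TpH
        ((TpH.map (TemperedGraphGroupData.exists_completion_of_prop36 S.Gc h36
        S.chart).choose_spec.choose.toMonoidHom).topologicalClosure) (Subgroup.le_topologicalClosure _)
        cuspMeetsH).Jhat i).subgroupOf (ofSpecialFibre X d S h36 Sigma SigmaHat hsub hne hprime hp TpH
      ((TpH.map (TemperedGraphGroupData.exists_completion_of_prop36 S.Gc h36
        S.chart).choose_spec.choose.toMonoidHom).topologicalClosure) (Subgroup.le_topologicalClosure _) cuspMeetsH).DeltaHat,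
          x ∈ (ofSpecialFibre X d S h36 Sigma SigmaHat hsub hne hprime hp TpH
      ((TpH.map (TemperedGraphGroupData.exists_completion_of_prop36 S.Gc h36
        S.chart).choose_spec.choose.toMonoidHom).topologicalClosure) (Subgroup.le_topologicalClosure _) cuspMeetsH).ρHat.ker → a * x = x * a) →
        a ∈ ((OfSpecialFibre.towerOfSpecialFibreTower X d T Sigma SigmaHat hsub hne hprime S h36 hp TpH
        ((TpH.map (TemperedGraphGroupData.exists_completion_of_prop36 S.Gc h36
        S.chart).choose_spec.choose.toMonoidHom).topologicalClosure) (Subgroup.le_topologicalClosure _)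
        cuspMeetsH).Jhat i).subgroupOf (ofSpecialFibre X d S h36 Sigma SigmaHat hsub hne hprime hp TpH
      ((TpH.map (TemperedGraphGroupData.exists_completion_of_prop36 S.Gc h36
        S.chart).choose_spec.choose.toMonoidHom).topologicalClosure) (Subgroup.le_topologicalClosure _) cuspMeetsH).DeltaHat)
    [Finite S.Gc.graph.Vertex] [Finite S.Gc.graph.Edge] (hcoh : S.Gc.IsCoherent)
    (hTpH : TpH ∈ S.chart.decompSubgroups P.H)
    (hgr : ∀ g : X.PiTemp, ∃ F : ProfiniteSemiGraph.Hom S.Gc S.Gc, F.IsLocallyTrivial ∧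
      F.base = (P.actGraph₀ g).hom ∧
      F.Induces S.chart S.chart ⟨S.autHom P.admissibleKer_normal_pi g, S.continuous_autHom P.admissibleKer_normal_pi g⟩) :
    ((ofSpecialFibre X d S h36 Sigma SigmaHat hsub hne hprime hp TpH
      ((TpH.map (TemperedGraphGroupData.exists_completion_of_prop36 S.Gc h36
        S.chart).choose_spec.choose.toMonoidHom).topologicalClosure) (Subgroup.le_topologicalClosure _) cuspMeetsH).Cor23i ∧
      (ofSpecialFibre X d S h36 Sigma SigmaHat hsub hne hprime hp TpH
      ((TpH.map (TemperedGraphGroupData.exists_completion_of_prop36 S.Gc h36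
        S.chart).choose_spec.choose.toMonoidHom).topologicalClosure) (Subgroup.le_topologicalClosure _) cuspMeetsH).Cor23ii ∧
      (ofSpecialFibre X d S h36 Sigma SigmaHat hsub hne hprime hp TpH
      ((TpH.map (TemperedGraphGroupData.exists_completion_of_prop36 S.Gc h36
        S.chart).choose_spec.choose.toMonoidHom).topologicalClosure) (Subgroup.le_topologicalClosure _) cuspMeetsH).Cor23iii ∧
      (ofSpecialFibre X d S h36 Sigma SigmaHat hsub hne hprime hp TpH
      ((TpH.map (TemperedGraphGroupData.exists_completion_of_prop36 S.Gc h36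
        S.chart).choose_spec.choose.toMonoidHom).topologicalClosure) (Subgroup.le_topologicalClosure _) cuspMeetsH).Cor23iv) ∧
      (ofSpecialFibre X d S h36 Sigma SigmaHat hsub hne hprime hp TpH
      ((TpH.map (TemperedGraphGroupData.exists_completion_of_prop36 S.Gc h36
        S.chart).choose_spec.choose.toMonoidHom).topologicalClosure) (Subgroup.le_topologicalClosure _) cuspMeetsH).Cor23v :=
  cor23_i_to_v_ofSpecialFibre_closureH_of_piData_of_mem_decompSubgroups X d S h36 Sigma SigmaHat hsub hne hprime hp TpH
    cuspMeetsH T P hA hB hcoh hTpH P.H_connected (ProfiniteSemiGraph.hasVertex_restrict_of_mem P.baseVertex_mem)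
    (hHstab_of_mem_decompSubgroups_of_graphic X d S TpH T P hgr hTpH)

end Block

end StableCurveTemperedData

end Literature.IUT.HodgeTheaters

end
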